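import Literature.AlgebraicGeometry.Frobenioids.MotivatingExamplesBiratNormalized
import Literature.AlgebraicGeometry.Frobenioids.GeometricFrobenioidStandard
import HarnessLib

/-!
# Frobenioids I, Theorem 6.2 (iii): `C_{K̃/K}` is of birationally Frobenius-normalized type —
# UNCONDITIONAL over `GeometricDivisorData` v4, at THE birationalization — PROOF

Mochizuki, *The geometry of Frobenioids I: the general theory*, Kyushu J. Math. **62** (2008) 293–400,
Theorem 6.2 (iii), kurims text p. 111 l. 30–31: "`C` is of … model — hence birationally Frobenius-normalized —
type [cf. Theorem 5.2, (ii)]" [cite: MochizukiFrdI2008, Thm. 6.2 (iii) p.111].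

PROOF-ONLY (seat abc-iut-L1-t3 gen 4, the typer of the schema `Thm62iii`; sub-DAG
`plan/L1/SUBDAG-FrdI-Thm64.md` row **T62iii/L02**, assembly (α) of the typer census
`staging/L1/L1-t3/g4/SUBDAG-FrdI-Thm64-status-v2.md`). abc-iut-L1-d10's `MotivatingExamplesBiratNormalized.lean`
(p411753) proves the row MODULO the standing hypotheses `Thm62_geomHypotheses Γ` (row T62ii/L03); abc-iut-L6-t10's
`GeometricFrobenioidStandard.lean` (p413795) proves those hypotheses for EVERY `Γ : GeometricDivisorData K K̃`
(v4 field `sub_mem`, p413022). Composing the two: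
* `Thm62_hasBiratSquares` — the square-completion input of the birationalization of `C_{K̃/K} → F_Φ`, no hypothesis;
* `Thm62_isOfBiratFrobeniusNormalizedType` — **T62iii/L02 unconditional**: `C_{K̃/K}` is of birationally
  Frobenius-normalized type (Def. 4.5 (i)) w.r.t. THE birationalization `PreFrobenioid.biratData` (any
  square-completion witness `hsq`), and the primed form with `hsq` supplied;
* `Thm62iii_biratData_iff` — abc-iut-L1-t3's schema `Thm62iii` at THE model `geomModelFrobenioid Γ` AND THE
  birationalization reduces to the SINGLE printed clause "support hypothesis ⇒ rationally standard type"
  (sharpening `Thm62iii_iff_inputs`, whose `Bi` was a free parameter).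
No definitions; nothing here bears on [IUTchIII] or asserts anything about abc.
-/

noncomputable section

namespace Literature.AlgebraicGeometry.Frobenioids

open CategoryTheory

variable {K : Type} [Field K] {Kt : Type} [Field Kt] [Algebra K Kt] (Γ : GeometricDivisorData K Kt)
  [IsGalois K Kt]

/-- The square-completion property ([FrdI] Prop. 1.11 (vii)) of `C_{K̃/K} → F_Φ` — the input `hsq` of its
birationalization — for EVERY `Γ` (v4). [cite: MochizukiFrdI2008, Thm. 6.2 p.110] -/
theorem Thm62_hasBiratSquares :
    PreFrobenioid.HasBiratSquares
      (ModelFrobenioid.toElem (geomDivisorFunctor Γ) (geomUnitsFunctor Γ) (geomDivNatTrans Γ)) :=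
  Thm62_hasBiratSquares_of_hypotheses Γ (Thm62_geomHypotheses_holds Γ)

/-- **T62iii/L02, unconditional** — `C_{K̃/K}` is of birationally Frobenius-normalized type (Thm. 6.2 (iii)
"model — hence birationally Frobenius-normalized — type", p. 111 l. 30–31) with respect to THE
birationalization `PreFrobenioid.biratData`, for EVERY `Γ : GeometricDivisorData K K̃` with `K̃/K` Galois and
any square-completion witness `hsq`. [cite: MochizukiFrdI2008, Thm. 6.2 (iii) p.111] -/
theorem Thm62_isOfBiratFrobeniusNormalizedType
    (hsq : PreFrobenioid.HasBiratSquares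
      (ModelFrobenioid.toElem (geomDivisorFunctor Γ) (geomUnitsFunctor Γ) (geomDivNatTrans Γ))) :
    PreFrobenioidData.IsOfBiratFrobeniusNormalizedType
      (PreFrobenioid.biratData (geomFrobenioid_isFrobenioid Γ) hsq) :=
  Thm62_isOfBiratFrobeniusNormalizedType_of_hypotheses Γ (Thm62_geomHypotheses_holds Γ) hsq

/-- **T62iii/L02, unconditional, square-completion witness supplied.**
[cite: MochizukiFrdI2008, Thm. 6.2 (iii) p.111] -/
theorem Thm62_isOfBiratFrobeniusNormalizedType' :
    PreFrobenioidData.IsOfBiratFrobeniusNormalizedType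
      (PreFrobenioid.biratData (geomFrobenioid_isFrobenioid Γ) (Thm62_hasBiratSquares Γ)) :=
  Thm62_isOfBiratFrobeniusNormalizedType Γ _

/-- **Theorem 6.2 (iii) at THE model and THE birationalization, REDUCED to its one printed conditional clause**:
abc-iut-L1-t3's schema `Thm62iii (geomModelFrobenioid Γ) Bi R` with `Bi :=` THE birationalization holds iff
"support hypothesis (p. 112 l. 4–5) ⇒ `C` of rationally standard type w.r.t. `R`" — isotropic, standard,
birationally Frobenius-normalized and not-group-like being PROVED. [cite: MochizukiFrdI2008, Thm. 6.2 (iii) p.111] -/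
theorem Thm62iii_biratData_iff
    (hsq : PreFrobenioid.HasBiratSquares
      (ModelFrobenioid.toElem (geomDivisorFunctor Γ) (geomUnitsFunctor Γ) (geomDivNatTrans Γ)))
    (R : (geomModelFrobenioid Γ).ops.RSParams) :
    Thm62iii (geomModelFrobenioid Γ) (PreFrobenioid.biratData (geomFrobenioid_isFrobenioid Γ) hsq) R ↔
      ((∀ (X : FinSubextCat K Kt) (P : Γ.primeDiv X), ∃ f : Γ.B X,
          (Multiplicative.toAdd (Γ.div X f)) P ≠ 0) → (geomFrobenioidOps Γ).IsOfRationallyStandardType R) := by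
  rw [Thm62iii_iff_inputs]
  exact ⟨fun h => h.2, fun h => ⟨Thm62_isOfBiratFrobeniusNormalizedType Γ hsq, h⟩⟩

end Literature.AlgebraicGeometry.Frobenioids

end
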